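import Summits.QuantumFields.BalabanUV.Beta.GAN24.ContactRefineBUnits

/-!
# `BalabanUV.Beta.GAN24.ContactRefineBThree` — binder row G-an2-4 / (CONV-C), the row owner's CONTACT-TERM ROUTE, **CT-4c-B at `d = 3`**, PART 2 of 2: THE B-ATOMS OF THE
# CONTACT CELLS (gauge weight × UNDRESSED partner × tent force, after my lineage's `cell_eq` and leaf-01's `ContactCellSplit.split_tip ∕ split_mid ∕ split_site`)
# ACROSS TWO CONSECUTIVE TOWERS, IN UNITS — «CT-3c's B-bound with one slot differenced», PARAMETRIC in the native letters of the suppliers.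

NOT IN PRINT; OUR BOOKKEEPING (G-an2-4 formalisation swarm, leaf prover `b2b-balaban-gan24-formalise-leaf-02`, gen 50; INTENT «CT-4c-B THREE» journal
`CLAIMS.log` l.35669; the P-atoms (dressed partner's gauge part) are gan24-p2 g34's CT-4c-P `ContactRefineP*`).  HONEST FRAMING (cell contract, verbatim):
«discharging `BetaPertH` makes Bałaban's UV stability UNCONDITIONAL — a real constructive-QFT result; it is NOT the continuum limit and NOT the Clay problem.»
HONEST DEPENDENCY (verbatim): «continuum YM on T⁴ ⇐ BetaPertH ∧ nine spine estimates (0/9 proved); BetaPertH ⇐ (D1) ∧ (D4) ∧ CAP+tail; G-an2-4 gates asym,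
D1 and NE2/3/4.»

SETTING (`d = 3`, `Lc ≥ 2`, in-block root `ρ = toSite rr`; tower `k`: blocking `N = Lc^(k+1)`, bond gauge function of the datum `(α, x′)`
`λ_k u = Psi ρ Lc 0 k (delta1 α x′) u − bmGaugeAt ρ (respStep 1 (Lc^(k+1)) α x′) Lc u`, undressed partner `B_k κ u = respStep 1 (Lc^(k+1)) κ′ u′ κ u` of the datum
`(κ′, u′)`, tent force `t_k κ u = 𝒬ᵀ_N φ_{β,z′} κ u`, `φ_{β,z′} l y = wΦ_N l β (y − z′)` of the datum `(β, z′)` (= `d*d` of either partner at `m = 0`, leaf-01's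
`ContactCellLetters.curvAdj_curv_respStep_zero_eq_contourSumAdj` ∕ `…legChain…`); tower `k+1`: the same at `k+1`, on the `Lc`-times finer lattice).
UNITS: `N^4·λ`, `N^5·B`, `N^7·t` are `O(1)` with block envelopes `16C`, `C`, `Φ₀e^{κ₀}` (§1), so an atom `Σ'_u Σ_κ w·B·t` carries `N^{−16}·N^4 = N^{−12}`:
the comparison is `|N′^{12}·atom_{k+1} − N^{12}·atom_k|` (`N′ = Lc·N`; the hS0 assembly's weight is `cE·(cE·Lc^8)^{k+1} = Lc^4·N^{12}`, owner's part A).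

WHAT (0 `def`, 0 cited fact, 0 `def … : Prop`, 0 sorry; [folklore] unit bookkeeping BY NAME over PART 1 `ContactRefineBUnits`, my `ContactCellRefine.abs_refine3_le`
and `ContactCellRefineTip.abs_refine3_tip_le ∕ _mid_le`).  PARAMETRIC in five letter families at ONE rate `κ₀` ((N1) `C`; tent bound `Φ₀`; ε₁ `c₁, θ₁` = leaf-01's
`RespStepRefine` shape; ε₃ `A, B, θt` = p2's `ContactTentRefine.exists_tent_refine_three` shape; εψ `c, θ, C` = leaf-01's `ContactGaugeRefine` shape); the wrapper
discharging them at the suppliers' minimum rate is a separate short file.  **`abs_atomTip_refine_le`**, **`abs_atomMid_refine_le`**, **`abs_atomSite_refine_le`**: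
`|N′^{12}·atom_{k+1} − N^{12}·atom_k| ≤ 4·[e^{κ₀}·(16C·c₁θ₁^k·Φ₀e^{κ₀} + 16C·C·(Aθt^k + B·N⁻¹) + (16cθ^k + 8C·N⁻¹)·C·Φ₀e^{κ₀}) + 2e^{κ₀}·(k+1)·8LcC·N⁻¹·C·Φ₀e^{κ₀}]·Zl 4 (κ₀∕16)·e^{−(κ₀∕12)(‖u′−x′‖∞+‖z′−x′‖∞)}`
(tip ∕ mid; the site END without the `e^{κ₀}` weight factor and without the realignment) — every summand GEOMETRIC in `k` at `max(θ₁, θt, θ, Lc⁻¹)` up to the one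
log `(k+1)·Lc^{−(k+1)}` (CT4-DESIGN §2 (δ)).  Discharges NOTHING of hSdev by itself (CT-4e adds the atoms per cell of leaf-01's `contact_legChain_ff_eq_cells`);
0 wall binders; NEVER «G-an2-4 closed» as (CONV-C); NOT D1, NOT BetaPertH, NOT continuum, NOT Clay.
-/

noncomputable section

open Finset
open scoped BigOperators
open Literature.MathematicalPhysics.QuantumFieldTheory
open Literature.MathematicalPhysics.QuantumFieldTheory.LatticeForm (quo)
open Literature.MathematicalPhysics.QuantumFieldTheory.Balaban1983to89
open Literature.MathematicalPhysics.QuantumFieldTheory.Balaban1983to89.Beta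
open B4ContourShift (supNorm supNorm_nonneg)
open ExpKernelCalculus (Zl Zl_nonneg)
open AffineAveraging (Form0 Form1 Site box toSite)
open AffineReproduction (contourSumAdj)
open AveragingContours (blk)
open KernelSpecInstance (wΦ)
open B6BondElimination (unitVec unitVec_apply)
open KKTFluctuationKernel (delta1)
open BalabanCompositeJets (respStep)
open Summit.QuantumFields.BalabanUV.Beta.AxialProjectorBlockMean (bmGaugeAt)
open Summit.QuantumFields.BalabanUV.Beta.GAN24.RespStepBmDecompLegs (legAct)
open Summit.QuantumFields.BalabanUV.Beta.GAN24.RespStepBmDecompPsi (Psi)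
open Summit.QuantumFields.BalabanUV.Beta.GAN24.StaircaseFaces (quo_quo)
open Summit.QuantumFields.BalabanUV.Beta.GAN24.ContactCellRefine (quo_quo' abs_refine3_le)
open Summit.QuantumFields.BalabanUV.Beta.GAN24.ContactCellRefineTip (abs_refine3_tip_le abs_refine3_mid_le)

open Summit.QuantumFields.BalabanUV.Beta.GAN24.ContactRefineBUnits (abs_unitGauge_le abs_unitLeg_le abs_unitTent_le abs_unitLeg_refine_le
  abs_unitTent_refine_le abs_unitGauge_refine_le unitGauge_eq_staircase abs_unitGaugePiece_le sum_unitAmp_eq)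

namespace Summit.QuantumFields.BalabanUV.Beta.GAN24.ContactRefineBThree

variable {Lc : ℕ} [NeZero Lc]

/-! ## The three B-atom ENDs (`d = 3`) -/

section Atoms

variable {κ₀ C Φ₀ c₁ θ₁ A B θt c θ : ℝ} {rr : Fin (3 + 1) → ℕ}

/-- NOT IN PRINT; OUR BOOKKEEPING.  **THE TIP B-ATOM ACROSS TWO CONSECUTIVE TOWERS, IN UNITS** (`d = 3`; the atom `Σ'_u Σ_κ λ(u+e_κ)·B κ u·t κ u` of
`cell_eq` ∕ `ContactCellSplit.split_tip` with the UNDRESSED partner `B` and the tent force `t`; tower `k+1` on its fine′ lattice against tower `k`):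
`|N′^{12}·atomTip_{k+1} − N^{12}·atomTip_k| ≤ 4·[e^{κ₀}·(16C·c₁θ₁^k·Φ₀e^{κ₀} + 16C·C·(Aθt^k + B·N⁻¹) + (16cθ^k + 8C·N⁻¹)·C·Φ₀e^{κ₀}) + 2e^{κ₀}·((k+1)·8LcC·N⁻¹)·C·Φ₀e^{κ₀}]·Zl 4 (κ₀∕16)·e^{−(κ₀∕12)(‖u′−x′‖∞+‖z′−x′‖∞)}`
— PART 3's `abs_refine3_tip_le` on §1's unit letters; PARAMETRIC in (N1) `C`, the tent bound `Φ₀`, and the three refinement letters (ε₁: `c₁, θ₁`; ε₃: `A, B, θt`;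
εψ: `c, θ, C`), all at the rate `κ₀`. -/
theorem abs_atomTip_refine_le (hLc : 2 ≤ Lc) (hrr : rr ∈ box (3 + 1) Lc) (hκ : 0 < κ₀) (hC : 0 ≤ C) (hΦ : 0 ≤ Φ₀)
    (hc₁ : 0 ≤ c₁) (hθ₁ : 0 ≤ θ₁) (hA : 0 ≤ A) (hB : 0 ≤ B) (hθt : 0 ≤ θt) (hc : 0 ≤ c) (hθ : 0 ≤ θ)
    (hN1 : ∀ (m k : ℕ) (μ : Fin (3 + 1)) (z : Site (3 + 1)) (l'' : Fin (3 + 1)) (w' : Site (3 + 1)),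
      |respStep (d := 3) (Lc ^ m) (Lc ^ (m + k + 1)) μ z l'' w'| ≤
        C * ((Lc : ℝ) ^ (5 * (k + 1)))⁻¹ * Real.exp (-(κ₀ * supNorm (quo (Lc ^ (k + 1)) w' - z))))
    (ht : ∀ (k : ℕ) (μ : Fin (3 + 1)) (z : Site (3 + 1)) (κ : Fin (3 + 1)) (u : Site (3 + 1)),
      |contourSumAdj (Lc ^ (k + 1)) (fun κ y => wΦ (N := Lc ^ (k + 1)) κ μ (y - z)) κ u|
        ≤ (Lc ^ (k + 1) : ℕ) * (Φ₀ * ((Lc : ℝ) ^ (8 * (k + 1)))⁻¹) * Real.exp κ₀ * Real.exp (-(κ₀ * supNorm (quo (Lc ^ (k + 1)) u - z))))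
    (hdB : ∀ (k : ℕ) (μ : Fin (3 + 1)) (z : Site (3 + 1)) (l : Fin (3 + 1)) (v : Site (3 + 1)),
      |(Lc : ℝ) ^ (3 + 2) * respStep (d := 3) 1 (Lc ^ (k + 1 + 1)) μ z l v - respStep (d := 3) 1 (Lc ^ (k + 1)) μ z l (quo Lc v)|
        ≤ c₁ * θ₁ ^ k * (((Lc : ℝ) ^ (k + 1)) ^ (3 + 2))⁻¹ * Real.exp (-(κ₀ * supNorm (quo (Lc ^ (k + 1 + 1)) v - z))))
    (hdt : ∀ (k : ℕ) (μ : Fin (3 + 1)) (z : Site (3 + 1)) (κ : Fin (3 + 1)) (x : Site (3 + 1)),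
      |(((Lc ^ (k + 1 + 1) : ℕ) : ℝ))⁻¹ *
            contourSumAdj (Lc ^ (k + 1 + 1))
              (fun κ' y => (((Lc : ℝ) ^ (k + 1 + 1)) ^ (2 * (3 + 1))) * wΦ (N := Lc ^ (k + 1 + 1)) (d := 3) κ' μ (y - z)) κ x
          - (((Lc ^ (k + 1) : ℕ) : ℝ))⁻¹ *
            contourSumAdj (Lc ^ (k + 1))
              (fun κ' y => (((Lc : ℝ) ^ (k + 1)) ^ (2 * (3 + 1))) * wΦ (N := Lc ^ (k + 1)) (d := 3) κ' μ (y - z)) κ (quo Lc x)|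
        ≤ (A * θt ^ k + B * (((Lc ^ (k + 1) : ℕ) : ℝ))⁻¹) * Real.exp (-(κ₀ * supNorm (quo (Lc ^ (k + 1)) (quo Lc x) - z))))
    (hdl : ∀ (k : ℕ) (μ : Fin (3 + 1)) (z : Site (3 + 1)) (u' : Site (3 + 1)),
      |(Psi (toSite rr) Lc 0 (k + 1) (delta1 μ z) u' - bmGaugeAt (toSite rr) (respStep (d := 3) 1 (Lc ^ (k + 2)) μ z) Lc u')
          - ((Lc : ℝ) ^ (3 + 1))⁻¹ *
            (Psi (toSite rr) Lc 0 k (delta1 μ z) (blk Lc u') - bmGaugeAt (toSite rr) (respStep (d := 3) 1 (Lc ^ (k + 1)) μ z) Lc (blk Lc u'))|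
        ≤ (16 * (Lc : ℝ) * c * θ ^ k * ((Lc : ℝ) ^ (5 * (k + 2)))⁻¹ * (Lc : ℝ) ^ (k + 1) + 8 * (Lc : ℝ) * C * ((Lc : ℝ) ^ (5 * (k + 2)))⁻¹) *
          Real.exp (-(κ₀ * supNorm (quo (Lc ^ (k + 2)) u' - z))))
    (k : ℕ) (κ' : Fin (3 + 1)) (u' : Site (3 + 1)) (α : Fin (3 + 1)) (x' : Site (3 + 1)) (β : Fin (3 + 1)) (z' : Site (3 + 1)) :
    |((Lc : ℝ) ^ (k + 2)) ^ 12 *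
        (∑' x : Site (3 + 1), ∑ κ,
          (Psi (toSite rr) Lc 0 (k + 1) (delta1 α x') - bmGaugeAt (toSite rr) (respStep (d := 3) 1 (Lc ^ (k + 2)) α x') Lc) (x + unitVec κ)
            * respStep (d := 3) 1 (Lc ^ (k + 2)) κ' u' κ x
            * contourSumAdj (Lc ^ (k + 2)) (fun l y => wΦ (N := Lc ^ (k + 2)) (d := 3) l β (y - z')) κ x)
      - ((Lc : ℝ) ^ (k + 1)) ^ 12 *
        (∑' cc : Site (3 + 1), ∑ κ,
          (Psi (toSite rr) Lc 0 k (delta1 α x') - bmGaugeAt (toSite rr) (respStep (d := 3) 1 (Lc ^ (k + 1)) α x') Lc) (cc + unitVec κ)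
            * respStep (d := 3) 1 (Lc ^ (k + 1)) κ' u' κ cc
            * contourSumAdj (Lc ^ (k + 1)) (fun l y => wΦ (N := Lc ^ (k + 1)) (d := 3) l β (y - z')) κ cc)|
      ≤ ((((3 : ℕ) : ℝ)) + 1) *
          (Real.exp κ₀ * ((16 * C) * (c₁ * θ₁ ^ k) * (Φ₀ * Real.exp κ₀) + (16 * C) * C * (A * θt ^ k + B * ((Lc : ℝ) ^ (k + 1))⁻¹)
              + (16 * c * θ ^ k + 8 * C * ((Lc : ℝ) ^ (k + 1))⁻¹) * C * (Φ₀ * Real.exp κ₀))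
            + 2 * Real.exp κ₀ * (((k : ℝ) + 1) * (8 * (Lc : ℝ) * C * ((Lc : ℝ) ^ (k + 1))⁻¹)) * (C * (Φ₀ * Real.exp κ₀))) *
        (Zl (3 + 1) (κ₀ / (4 * ((((3 : ℕ) : ℝ)) + 1))) * Real.exp (-(κ₀ / 12) * (supNorm (u' - x') + supNorm (z' - x')))) := by
  have hL : 1 ≤ Lc := by omega
  have hL0 : (Lc : ℝ) ≠ 0 := by exact_mod_cast NeZero.ne Lc
  have hLpos : (0 : ℝ) < (Lc : ℝ) := by exact_mod_cast Nat.pos_of_ne_zero (NeZero.ne Lc)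
  have hN : 1 ≤ Lc ^ (k + 1) := Nat.one_le_pow _ _ (Nat.pos_of_ne_zero (NeZero.ne Lc))
  have hN' : Lc ^ (k + 2) = Lc * Lc ^ (k + 1) := pow_succ' Lc (k + 1)
  have hP : ∀ s, s ≤ k → 1 ≤ Lc ^ s := fun s _ => Nat.one_le_pow _ _ (Nat.pos_of_ne_zero (NeZero.ne Lc))
  have hPN : ∀ s, s ≤ k → Lc ^ s ∣ Lc ^ (k + 1) := fun s hs => pow_dvd_pow Lc (by omega)
  have hEψ : (0 : ℝ) ≤ 16 * C := by positivity
  have hE₃ : (0 : ℝ) ≤ Φ₀ * Real.exp κ₀ := by positivity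
  have hε₁ : (0 : ℝ) ≤ c₁ * θ₁ ^ k := by positivity
  have hε₃ : (0 : ℝ) ≤ A * θt ^ k + B * ((Lc : ℝ) ^ (k + 1))⁻¹ := by positivity
  have hεψ : (0 : ℝ) ≤ 16 * c * θ ^ k + 8 * C * ((Lc : ℝ) ^ (k + 1))⁻¹ := by positivity
  have ha : ∀ s : ℕ, (0 : ℝ) ≤ 8 * (Lc : ℝ) * C * ((Lc : ℝ) ^ (k + 1))⁻¹ * (Lc : ℝ) ^ s := fun s => by positivity
  set lam' : Form0 (3 + 1) ℝ := Psi (toSite rr) Lc 0 (k + 1) (delta1 α x') - bmGaugeAt (toSite rr) (respStep (d := 3) 1 (Lc ^ (k + 2)) α x') Lc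
    with hlam'
  set lam : Form0 (3 + 1) ℝ := Psi (toSite rr) Lc 0 k (delta1 α x') - bmGaugeAt (toSite rr) (respStep (d := 3) 1 (Lc ^ (k + 1)) α x') Lc with hlam
  set B' : Form1 (3 + 1) ℝ := respStep (d := 3) 1 (Lc ^ (k + 2)) κ' u' with hB'
  set B₀ : Form1 (3 + 1) ℝ := respStep (d := 3) 1 (Lc ^ (k + 1)) κ' u' with hB₀
  set t' : Form1 (3 + 1) ℝ := contourSumAdj (Lc ^ (k + 2)) (fun l y => wΦ (N := Lc ^ (k + 2)) (d := 3) l β (y - z')) with ht'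
  set t₀ : Form1 (3 + 1) ℝ := contourSumAdj (Lc ^ (k + 1)) (fun l y => wΦ (N := Lc ^ (k + 1)) (d := 3) l β (y - z')) with ht₀
  have hψ' : ∀ y : Site (3 + 1), |((Lc : ℝ) ^ (k + 2)) ^ 4 * lam' y| ≤ 16 * C * Real.exp (-(κ₀ * supNorm (quo (Lc ^ (k + 2)) y - x'))) :=
    fun y => abs_unitGauge_le hLc hC hN1 hrr (k + 1) α x' y
  have hψ : ∀ y : Site (3 + 1), |((Lc : ℝ) ^ (k + 1)) ^ 4 * lam y| ≤ 16 * C * Real.exp (-(κ₀ * supNorm (quo (Lc ^ (k + 1)) y - x'))) :=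
    fun y => abs_unitGauge_le hLc hC hN1 hrr k α x' y
  have hG := fun (s : ℕ) (hs : s ≤ k) (y : Site (3 + 1)) => abs_unitGaugePiece_le (κ₀ := κ₀) hN1 hrr k α x' hs y
  have hψG := fun (y : Site (3 + 1)) => unitGauge_eq_staircase (Lc := Lc) (toSite rr) k α x' y
  have hM' : ∀ κ y, |((Lc : ℝ) ^ (k + 2)) ^ 7 * t' κ y| ≤ Φ₀ * Real.exp κ₀ * Real.exp (-(κ₀ * supNorm (quo (Lc ^ (k + 2)) y - z'))) :=
    fun κ y => abs_unitTent_le ht (k + 1) β z' κ y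
  have hT : ∀ κ y, |((Lc : ℝ) ^ (k + 1)) ^ 5 * B₀ κ y| ≤ C * Real.exp (-(κ₀ * supNorm (quo (Lc ^ (k + 1)) y - u'))) :=
    fun κ y => abs_unitLeg_le hN1 k κ' u' κ y
  have hM : ∀ κ y, |((Lc : ℝ) ^ (k + 1)) ^ 7 * t₀ κ y| ≤ Φ₀ * Real.exp κ₀ * Real.exp (-(κ₀ * supNorm (quo (Lc ^ (k + 1)) y - z'))) :=
    fun κ y => abs_unitTent_le ht k β z' κ y
  have hdT : ∀ κ y, |((Lc : ℝ) ^ (k + 2)) ^ 5 * B' κ y - ((Lc : ℝ) ^ (k + 1)) ^ 5 * B₀ κ (quo Lc y)|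
      ≤ c₁ * θ₁ ^ k * Real.exp (-(κ₀ * supNorm (quo (Lc ^ (k + 2)) y - u'))) := fun κ y => abs_unitLeg_refine_le hdB k κ' u' κ y
  have hdM : ∀ κ y, |((Lc : ℝ) ^ (k + 2)) ^ 7 * t' κ y - ((Lc : ℝ) ^ (k + 1)) ^ 7 * t₀ κ (quo Lc y)|
      ≤ (A * θt ^ k + B * ((Lc : ℝ) ^ (k + 1))⁻¹) * Real.exp (-(κ₀ * supNorm (quo (Lc ^ (k + 2)) y - z'))) :=
    fun κ y => abs_unitTent_refine_le hdt k β z' κ y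
  have hdψ : ∀ y : Site (3 + 1), |((Lc : ℝ) ^ (k + 2)) ^ 4 * lam' y - ((Lc : ℝ) ^ (k + 1)) ^ 4 * lam (quo Lc y)|
      ≤ (16 * c * θ ^ k + 8 * C * ((Lc : ℝ) ^ (k + 1))⁻¹) * Real.exp (-(κ₀ * supNorm (quo (Lc ^ (k + 2)) y - x'))) :=
    fun y => abs_unitGauge_refine_le hdl k α x' y
  have hN'12 : ((((Lc ^ (k + 2) : ℕ) : ℝ)) ^ (3 + 1))⁻¹ * ((Lc : ℝ) ^ (k + 2)) ^ 16 = ((Lc : ℝ) ^ (k + 2)) ^ 12 := by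
    rw [Nat.cast_pow]; field_simp
  have hN12 : ((((Lc ^ (k + 1) : ℕ) : ℝ)) ^ (3 + 1))⁻¹ * ((Lc : ℝ) ^ (k + 1)) ^ 16 = ((Lc : ℝ) ^ (k + 1)) ^ 12 := by
    rw [Nat.cast_pow]; field_simp
  obtain ⟨-, -, hEND⟩ := abs_refine3_tip_le (d := 3) (L := Lc) (N := Lc ^ (k + 1)) (N' := Lc ^ (k + 2)) (k := k) (κ₀ := κ₀)
    (ψ' := fun y => ((Lc : ℝ) ^ (k + 2)) ^ 4 * lam' y) (ψ := fun y => ((Lc : ℝ) ^ (k + 1)) ^ 4 * lam y)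
    (T' := fun κ y => ((Lc : ℝ) ^ (k + 2)) ^ 5 * B' κ y) (M' := fun κ y => ((Lc : ℝ) ^ (k + 2)) ^ 7 * t' κ y)
    (T := fun κ y => ((Lc : ℝ) ^ (k + 1)) ^ 5 * B₀ κ y) (M := fun κ y => ((Lc : ℝ) ^ (k + 1)) ^ 7 * t₀ κ y)
    (G := fun (s : ℕ) (y : Site (3 + 1)) => ((Lc : ℝ) ^ (k + 1)) ^ 4 *
      -(((Lc : ℝ) ^ ((3 + 1) * s))⁻¹ * bmGaugeAt (toSite rr) (legAct (respStep (d := 3) (Lc ^ s) (Lc ^ (k + 1))) (delta1 α x')) Lc y))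
    (a := fun s => 8 * (Lc : ℝ) * C * ((Lc : ℝ) ^ (k + 1))⁻¹ * (Lc : ℝ) ^ s) (P := fun s => Lc ^ s)
    (z₀ := x') (z₁ := u') (z₃ := z') (Eψ := 16 * C) (E₁ := C) (E₃ := Φ₀ * Real.exp κ₀)
    (εψ := 16 * c * θ ^ k + 8 * C * ((Lc : ℝ) ^ (k + 1))⁻¹) (ε₁ := c₁ * θ₁ ^ k) (ε₃ := A * θt ^ k + B * ((Lc : ℝ) ^ (k + 1))⁻¹)
    hL hN hN' hκ hEψ hC hE₃ hεψ hε₁ hε₃ ha hP hPN hψ' hψ hG hψG hM' hT hM hdT hdM hdψ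
  rw [sum_unitAmp_eq] at hEND
  have hpt' : ∀ y : Site (3 + 1), (∑ κ, ((Lc : ℝ) ^ (k + 2)) ^ 4 * lam' (y + unitVec κ) * (((Lc : ℝ) ^ (k + 2)) ^ 5 * B' κ y) *
      (((Lc : ℝ) ^ (k + 2)) ^ 7 * t' κ y)) = ((Lc : ℝ) ^ (k + 2)) ^ 16 * ∑ κ, lam' (y + unitVec κ) * B' κ y * t' κ y := by
    intro y; rw [Finset.mul_sum]; exact Finset.sum_congr rfl fun κ _ => by ring
  have hpt : ∀ y : Site (3 + 1), (∑ κ, ((Lc : ℝ) ^ (k + 1)) ^ 4 * lam (y + unitVec κ) * (((Lc : ℝ) ^ (k + 1)) ^ 5 * B₀ κ y) *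
      (((Lc : ℝ) ^ (k + 1)) ^ 7 * t₀ κ y)) = ((Lc : ℝ) ^ (k + 1)) ^ 16 * ∑ κ, lam (y + unitVec κ) * B₀ κ y * t₀ κ y := by
    intro y; rw [Finset.mul_sum]; exact Finset.sum_congr rfl fun κ _ => by ring
  rw [tsum_congr hpt', tsum_congr hpt, tsum_mul_left, tsum_mul_left, ← mul_assoc, ← mul_assoc, hN'12, hN12] at hEND
  exact hEND

/-- NOT IN PRINT; OUR BOOKKEEPING.  **THE MIDPOINT B-ATOM ACROSS TWO CONSECUTIVE TOWERS, IN UNITS** (the atom `Σ'_z Σ_β ½(λ z + λ(z+e_β))·B β z·t β z` of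
`cell_eq` ∕ `split_mid`): the same bound as the tip atom (PART 3's `abs_refine3_mid_le`). -/
theorem abs_atomMid_refine_le (hLc : 2 ≤ Lc) (hrr : rr ∈ box (3 + 1) Lc) (hκ : 0 < κ₀) (hC : 0 ≤ C) (hΦ : 0 ≤ Φ₀)
    (hc₁ : 0 ≤ c₁) (hθ₁ : 0 ≤ θ₁) (hA : 0 ≤ A) (hB : 0 ≤ B) (hθt : 0 ≤ θt) (hc : 0 ≤ c) (hθ : 0 ≤ θ)
    (hN1 : ∀ (m k : ℕ) (μ : Fin (3 + 1)) (z : Site (3 + 1)) (l'' : Fin (3 + 1)) (w' : Site (3 + 1)),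
      |respStep (d := 3) (Lc ^ m) (Lc ^ (m + k + 1)) μ z l'' w'| ≤
        C * ((Lc : ℝ) ^ (5 * (k + 1)))⁻¹ * Real.exp (-(κ₀ * supNorm (quo (Lc ^ (k + 1)) w' - z))))
    (ht : ∀ (k : ℕ) (μ : Fin (3 + 1)) (z : Site (3 + 1)) (κ : Fin (3 + 1)) (u : Site (3 + 1)),
      |contourSumAdj (Lc ^ (k + 1)) (fun κ y => wΦ (N := Lc ^ (k + 1)) κ μ (y - z)) κ u|
        ≤ (Lc ^ (k + 1) : ℕ) * (Φ₀ * ((Lc : ℝ) ^ (8 * (k + 1)))⁻¹) * Real.exp κ₀ * Real.exp (-(κ₀ * supNorm (quo (Lc ^ (k + 1)) u - z))))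
    (hdB : ∀ (k : ℕ) (μ : Fin (3 + 1)) (z : Site (3 + 1)) (l : Fin (3 + 1)) (v : Site (3 + 1)),
      |(Lc : ℝ) ^ (3 + 2) * respStep (d := 3) 1 (Lc ^ (k + 1 + 1)) μ z l v - respStep (d := 3) 1 (Lc ^ (k + 1)) μ z l (quo Lc v)|
        ≤ c₁ * θ₁ ^ k * (((Lc : ℝ) ^ (k + 1)) ^ (3 + 2))⁻¹ * Real.exp (-(κ₀ * supNorm (quo (Lc ^ (k + 1 + 1)) v - z))))
    (hdt : ∀ (k : ℕ) (μ : Fin (3 + 1)) (z : Site (3 + 1)) (κ : Fin (3 + 1)) (x : Site (3 + 1)),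
      |(((Lc ^ (k + 1 + 1) : ℕ) : ℝ))⁻¹ *
            contourSumAdj (Lc ^ (k + 1 + 1))
              (fun κ' y => (((Lc : ℝ) ^ (k + 1 + 1)) ^ (2 * (3 + 1))) * wΦ (N := Lc ^ (k + 1 + 1)) (d := 3) κ' μ (y - z)) κ x
          - (((Lc ^ (k + 1) : ℕ) : ℝ))⁻¹ *
            contourSumAdj (Lc ^ (k + 1))
              (fun κ' y => (((Lc : ℝ) ^ (k + 1)) ^ (2 * (3 + 1))) * wΦ (N := Lc ^ (k + 1)) (d := 3) κ' μ (y - z)) κ (quo Lc x)|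
        ≤ (A * θt ^ k + B * (((Lc ^ (k + 1) : ℕ) : ℝ))⁻¹) * Real.exp (-(κ₀ * supNorm (quo (Lc ^ (k + 1)) (quo Lc x) - z))))
    (hdl : ∀ (k : ℕ) (μ : Fin (3 + 1)) (z : Site (3 + 1)) (u' : Site (3 + 1)),
      |(Psi (toSite rr) Lc 0 (k + 1) (delta1 μ z) u' - bmGaugeAt (toSite rr) (respStep (d := 3) 1 (Lc ^ (k + 2)) μ z) Lc u')
          - ((Lc : ℝ) ^ (3 + 1))⁻¹ *
            (Psi (toSite rr) Lc 0 k (delta1 μ z) (blk Lc u') - bmGaugeAt (toSite rr) (respStep (d := 3) 1 (Lc ^ (k + 1)) μ z) Lc (blk Lc u'))|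
        ≤ (16 * (Lc : ℝ) * c * θ ^ k * ((Lc : ℝ) ^ (5 * (k + 2)))⁻¹ * (Lc : ℝ) ^ (k + 1) + 8 * (Lc : ℝ) * C * ((Lc : ℝ) ^ (5 * (k + 2)))⁻¹) *
          Real.exp (-(κ₀ * supNorm (quo (Lc ^ (k + 2)) u' - z))))
    (k : ℕ) (κ' : Fin (3 + 1)) (u' : Site (3 + 1)) (α : Fin (3 + 1)) (x' : Site (3 + 1)) (β : Fin (3 + 1)) (z' : Site (3 + 1)) :
    |((Lc : ℝ) ^ (k + 2)) ^ 12 *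
        (∑' x : Site (3 + 1), ∑ κ,
          ((Psi (toSite rr) Lc 0 (k + 1) (delta1 α x') - bmGaugeAt (toSite rr) (respStep (d := 3) 1 (Lc ^ (k + 2)) α x') Lc) x + (Psi (toSite rr) Lc 0 (k + 1) (delta1 α x') - bmGaugeAt (toSite rr) (respStep (d := 3) 1 (Lc ^ (k + 2)) α x') Lc) (x + unitVec κ)) / 2
            * respStep (d := 3) 1 (Lc ^ (k + 2)) κ' u' κ x
            * contourSumAdj (Lc ^ (k + 2)) (fun l y => wΦ (N := Lc ^ (k + 2)) (d := 3) l β (y - z')) κ x)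
      - ((Lc : ℝ) ^ (k + 1)) ^ 12 *
        (∑' cc : Site (3 + 1), ∑ κ,
          ((Psi (toSite rr) Lc 0 k (delta1 α x') - bmGaugeAt (toSite rr) (respStep (d := 3) 1 (Lc ^ (k + 1)) α x') Lc) cc + (Psi (toSite rr) Lc 0 k (delta1 α x') - bmGaugeAt (toSite rr) (respStep (d := 3) 1 (Lc ^ (k + 1)) α x') Lc) (cc + unitVec κ)) / 2
            * respStep (d := 3) 1 (Lc ^ (k + 1)) κ' u' κ cc
            * contourSumAdj (Lc ^ (k + 1)) (fun l y => wΦ (N := Lc ^ (k + 1)) (d := 3) l β (y - z')) κ cc)|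
      ≤ ((((3 : ℕ) : ℝ)) + 1) *
          (Real.exp κ₀ * ((16 * C) * (c₁ * θ₁ ^ k) * (Φ₀ * Real.exp κ₀) + (16 * C) * C * (A * θt ^ k + B * ((Lc : ℝ) ^ (k + 1))⁻¹)
              + (16 * c * θ ^ k + 8 * C * ((Lc : ℝ) ^ (k + 1))⁻¹) * C * (Φ₀ * Real.exp κ₀))
            + 2 * Real.exp κ₀ * (((k : ℝ) + 1) * (8 * (Lc : ℝ) * C * ((Lc : ℝ) ^ (k + 1))⁻¹)) * (C * (Φ₀ * Real.exp κ₀))) *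
        (Zl (3 + 1) (κ₀ / (4 * ((((3 : ℕ) : ℝ)) + 1))) * Real.exp (-(κ₀ / 12) * (supNorm (u' - x') + supNorm (z' - x')))) := by
  have hL : 1 ≤ Lc := by omega
  have hL0 : (Lc : ℝ) ≠ 0 := by exact_mod_cast NeZero.ne Lc
  have hLpos : (0 : ℝ) < (Lc : ℝ) := by exact_mod_cast Nat.pos_of_ne_zero (NeZero.ne Lc)
  have hN : 1 ≤ Lc ^ (k + 1) := Nat.one_le_pow _ _ (Nat.pos_of_ne_zero (NeZero.ne Lc))
  have hN' : Lc ^ (k + 2) = Lc * Lc ^ (k + 1) := pow_succ' Lc (k + 1)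
  have hP : ∀ s, s ≤ k → 1 ≤ Lc ^ s := fun s _ => Nat.one_le_pow _ _ (Nat.pos_of_ne_zero (NeZero.ne Lc))
  have hPN : ∀ s, s ≤ k → Lc ^ s ∣ Lc ^ (k + 1) := fun s hs => pow_dvd_pow Lc (by omega)
  have hEψ : (0 : ℝ) ≤ 16 * C := by positivity
  have hE₃ : (0 : ℝ) ≤ Φ₀ * Real.exp κ₀ := by positivity
  have hε₁ : (0 : ℝ) ≤ c₁ * θ₁ ^ k := by positivity
  have hε₃ : (0 : ℝ) ≤ A * θt ^ k + B * ((Lc : ℝ) ^ (k + 1))⁻¹ := by positivity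
  have hεψ : (0 : ℝ) ≤ 16 * c * θ ^ k + 8 * C * ((Lc : ℝ) ^ (k + 1))⁻¹ := by positivity
  have ha : ∀ s : ℕ, (0 : ℝ) ≤ 8 * (Lc : ℝ) * C * ((Lc : ℝ) ^ (k + 1))⁻¹ * (Lc : ℝ) ^ s := fun s => by positivity
  set lam' : Form0 (3 + 1) ℝ := Psi (toSite rr) Lc 0 (k + 1) (delta1 α x') - bmGaugeAt (toSite rr) (respStep (d := 3) 1 (Lc ^ (k + 2)) α x') Lc
    with hlam'
  set lam : Form0 (3 + 1) ℝ := Psi (toSite rr) Lc 0 k (delta1 α x') - bmGaugeAt (toSite rr) (respStep (d := 3) 1 (Lc ^ (k + 1)) α x') Lc with hlam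
  set B' : Form1 (3 + 1) ℝ := respStep (d := 3) 1 (Lc ^ (k + 2)) κ' u' with hB'
  set B₀ : Form1 (3 + 1) ℝ := respStep (d := 3) 1 (Lc ^ (k + 1)) κ' u' with hB₀
  set t' : Form1 (3 + 1) ℝ := contourSumAdj (Lc ^ (k + 2)) (fun l y => wΦ (N := Lc ^ (k + 2)) (d := 3) l β (y - z')) with ht'
  set t₀ : Form1 (3 + 1) ℝ := contourSumAdj (Lc ^ (k + 1)) (fun l y => wΦ (N := Lc ^ (k + 1)) (d := 3) l β (y - z')) with ht₀
  have hψ' : ∀ y : Site (3 + 1), |((Lc : ℝ) ^ (k + 2)) ^ 4 * lam' y| ≤ 16 * C * Real.exp (-(κ₀ * supNorm (quo (Lc ^ (k + 2)) y - x'))) :=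
    fun y => abs_unitGauge_le hLc hC hN1 hrr (k + 1) α x' y
  have hψ : ∀ y : Site (3 + 1), |((Lc : ℝ) ^ (k + 1)) ^ 4 * lam y| ≤ 16 * C * Real.exp (-(κ₀ * supNorm (quo (Lc ^ (k + 1)) y - x'))) :=
    fun y => abs_unitGauge_le hLc hC hN1 hrr k α x' y
  have hG := fun (s : ℕ) (hs : s ≤ k) (y : Site (3 + 1)) => abs_unitGaugePiece_le (κ₀ := κ₀) hN1 hrr k α x' hs y
  have hψG := fun (y : Site (3 + 1)) => unitGauge_eq_staircase (Lc := Lc) (toSite rr) k α x' y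
  have hM' : ∀ κ y, |((Lc : ℝ) ^ (k + 2)) ^ 7 * t' κ y| ≤ Φ₀ * Real.exp κ₀ * Real.exp (-(κ₀ * supNorm (quo (Lc ^ (k + 2)) y - z'))) :=
    fun κ y => abs_unitTent_le ht (k + 1) β z' κ y
  have hT : ∀ κ y, |((Lc : ℝ) ^ (k + 1)) ^ 5 * B₀ κ y| ≤ C * Real.exp (-(κ₀ * supNorm (quo (Lc ^ (k + 1)) y - u'))) :=
    fun κ y => abs_unitLeg_le hN1 k κ' u' κ y
  have hM : ∀ κ y, |((Lc : ℝ) ^ (k + 1)) ^ 7 * t₀ κ y| ≤ Φ₀ * Real.exp κ₀ * Real.exp (-(κ₀ * supNorm (quo (Lc ^ (k + 1)) y - z'))) :=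
    fun κ y => abs_unitTent_le ht k β z' κ y
  have hdT : ∀ κ y, |((Lc : ℝ) ^ (k + 2)) ^ 5 * B' κ y - ((Lc : ℝ) ^ (k + 1)) ^ 5 * B₀ κ (quo Lc y)|
      ≤ c₁ * θ₁ ^ k * Real.exp (-(κ₀ * supNorm (quo (Lc ^ (k + 2)) y - u'))) := fun κ y => abs_unitLeg_refine_le hdB k κ' u' κ y
  have hdM : ∀ κ y, |((Lc : ℝ) ^ (k + 2)) ^ 7 * t' κ y - ((Lc : ℝ) ^ (k + 1)) ^ 7 * t₀ κ (quo Lc y)|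
      ≤ (A * θt ^ k + B * ((Lc : ℝ) ^ (k + 1))⁻¹) * Real.exp (-(κ₀ * supNorm (quo (Lc ^ (k + 2)) y - z'))) :=
    fun κ y => abs_unitTent_refine_le hdt k β z' κ y
  have hdψ : ∀ y : Site (3 + 1), |((Lc : ℝ) ^ (k + 2)) ^ 4 * lam' y - ((Lc : ℝ) ^ (k + 1)) ^ 4 * lam (quo Lc y)|
      ≤ (16 * c * θ ^ k + 8 * C * ((Lc : ℝ) ^ (k + 1))⁻¹) * Real.exp (-(κ₀ * supNorm (quo (Lc ^ (k + 2)) y - x'))) :=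
    fun y => abs_unitGauge_refine_le hdl k α x' y
  have hN'12 : ((((Lc ^ (k + 2) : ℕ) : ℝ)) ^ (3 + 1))⁻¹ * ((Lc : ℝ) ^ (k + 2)) ^ 16 = ((Lc : ℝ) ^ (k + 2)) ^ 12 := by
    rw [Nat.cast_pow]; field_simp
  have hN12 : ((((Lc ^ (k + 1) : ℕ) : ℝ)) ^ (3 + 1))⁻¹ * ((Lc : ℝ) ^ (k + 1)) ^ 16 = ((Lc : ℝ) ^ (k + 1)) ^ 12 := by
    rw [Nat.cast_pow]; field_simp
  obtain ⟨-, -, hEND⟩ := abs_refine3_mid_le (d := 3) (L := Lc) (N := Lc ^ (k + 1)) (N' := Lc ^ (k + 2)) (k := k) (κ₀ := κ₀)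
    (ψ' := fun y => ((Lc : ℝ) ^ (k + 2)) ^ 4 * lam' y) (ψ := fun y => ((Lc : ℝ) ^ (k + 1)) ^ 4 * lam y)
    (T' := fun κ y => ((Lc : ℝ) ^ (k + 2)) ^ 5 * B' κ y) (M' := fun κ y => ((Lc : ℝ) ^ (k + 2)) ^ 7 * t' κ y)
    (T := fun κ y => ((Lc : ℝ) ^ (k + 1)) ^ 5 * B₀ κ y) (M := fun κ y => ((Lc : ℝ) ^ (k + 1)) ^ 7 * t₀ κ y)
    (G := fun (s : ℕ) (y : Site (3 + 1)) => ((Lc : ℝ) ^ (k + 1)) ^ 4 *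
      -(((Lc : ℝ) ^ ((3 + 1) * s))⁻¹ * bmGaugeAt (toSite rr) (legAct (respStep (d := 3) (Lc ^ s) (Lc ^ (k + 1))) (delta1 α x')) Lc y))
    (a := fun s => 8 * (Lc : ℝ) * C * ((Lc : ℝ) ^ (k + 1))⁻¹ * (Lc : ℝ) ^ s) (P := fun s => Lc ^ s)
    (z₀ := x') (z₁ := u') (z₃ := z') (Eψ := 16 * C) (E₁ := C) (E₃ := Φ₀ * Real.exp κ₀)
    (εψ := 16 * c * θ ^ k + 8 * C * ((Lc : ℝ) ^ (k + 1))⁻¹) (ε₁ := c₁ * θ₁ ^ k) (ε₃ := A * θt ^ k + B * ((Lc : ℝ) ^ (k + 1))⁻¹)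
    hL hN hN' hκ hEψ hC hE₃ hεψ hε₁ hε₃ ha hP hPN hψ' hψ hG hψG hM' hT hM hdT hdM hdψ
  rw [sum_unitAmp_eq] at hEND
  have hpt' : ∀ y : Site (3 + 1), (∑ κ, (((Lc : ℝ) ^ (k + 2)) ^ 4 * lam' y + ((Lc : ℝ) ^ (k + 2)) ^ 4 * lam' (y + unitVec κ)) / 2 *
      (((Lc : ℝ) ^ (k + 2)) ^ 5 * B' κ y) * (((Lc : ℝ) ^ (k + 2)) ^ 7 * t' κ y))
      = ((Lc : ℝ) ^ (k + 2)) ^ 16 * ∑ κ, (lam' y + lam' (y + unitVec κ)) / 2 * B' κ y * t' κ y := by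
    intro y; rw [Finset.mul_sum]; exact Finset.sum_congr rfl fun κ _ => by ring
  have hpt : ∀ y : Site (3 + 1), (∑ κ, (((Lc : ℝ) ^ (k + 1)) ^ 4 * lam y + ((Lc : ℝ) ^ (k + 1)) ^ 4 * lam (y + unitVec κ)) / 2 *
      (((Lc : ℝ) ^ (k + 1)) ^ 5 * B₀ κ y) * (((Lc : ℝ) ^ (k + 1)) ^ 7 * t₀ κ y))
      = ((Lc : ℝ) ^ (k + 1)) ^ 16 * ∑ κ, (lam y + lam (y + unitVec κ)) / 2 * B₀ κ y * t₀ κ y := by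
    intro y; rw [Finset.mul_sum]; exact Finset.sum_congr rfl fun κ _ => by ring
  rw [tsum_congr hpt', tsum_congr hpt, tsum_mul_left, tsum_mul_left, ← mul_assoc, ← mul_assoc, hN'12, hN12] at hEND
  exact hEND

/-- NOT IN PRINT; OUR BOOKKEEPING.  **THE SITE B-ATOM ACROSS TWO CONSECUTIVE TOWERS, IN UNITS** (the atom `Σ'_x Σ_a λ x·B a x·t a x` of `cellIdx_eq` ∕
`split_site`): PART 1's `abs_refine3_le` on §1's unit letters — no weight wobble, no realignment:
`|N′^{12}·atomSite_{k+1} − N^{12}·atomSite_k| ≤ 4·(16C·c₁θ₁^k·Φ₀e^{κ₀} + 16C·C·(Aθt^k + B·N⁻¹) + (16cθ^k + 8C·N⁻¹)·C·Φ₀e^{κ₀})·Zl 4 (κ₀∕16)·e^{−(κ₀∕12)(‖u′−x′‖∞+‖z′−x′‖∞)}`. -/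
theorem abs_atomSite_refine_le (hLc : 2 ≤ Lc) (hrr : rr ∈ box (3 + 1) Lc) (hκ : 0 < κ₀) (hC : 0 ≤ C) (hΦ : 0 ≤ Φ₀)
    (hc₁ : 0 ≤ c₁) (hθ₁ : 0 ≤ θ₁) (hA : 0 ≤ A) (hB : 0 ≤ B) (hθt : 0 ≤ θt) (hc : 0 ≤ c) (hθ : 0 ≤ θ)
    (hN1 : ∀ (m k : ℕ) (μ : Fin (3 + 1)) (z : Site (3 + 1)) (l'' : Fin (3 + 1)) (w' : Site (3 + 1)),
      |respStep (d := 3) (Lc ^ m) (Lc ^ (m + k + 1)) μ z l'' w'| ≤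
        C * ((Lc : ℝ) ^ (5 * (k + 1)))⁻¹ * Real.exp (-(κ₀ * supNorm (quo (Lc ^ (k + 1)) w' - z))))
    (ht : ∀ (k : ℕ) (μ : Fin (3 + 1)) (z : Site (3 + 1)) (κ : Fin (3 + 1)) (u : Site (3 + 1)),
      |contourSumAdj (Lc ^ (k + 1)) (fun κ y => wΦ (N := Lc ^ (k + 1)) κ μ (y - z)) κ u|
        ≤ (Lc ^ (k + 1) : ℕ) * (Φ₀ * ((Lc : ℝ) ^ (8 * (k + 1)))⁻¹) * Real.exp κ₀ * Real.exp (-(κ₀ * supNorm (quo (Lc ^ (k + 1)) u - z))))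
    (hdB : ∀ (k : ℕ) (μ : Fin (3 + 1)) (z : Site (3 + 1)) (l : Fin (3 + 1)) (v : Site (3 + 1)),
      |(Lc : ℝ) ^ (3 + 2) * respStep (d := 3) 1 (Lc ^ (k + 1 + 1)) μ z l v - respStep (d := 3) 1 (Lc ^ (k + 1)) μ z l (quo Lc v)|
        ≤ c₁ * θ₁ ^ k * (((Lc : ℝ) ^ (k + 1)) ^ (3 + 2))⁻¹ * Real.exp (-(κ₀ * supNorm (quo (Lc ^ (k + 1 + 1)) v - z))))
    (hdt : ∀ (k : ℕ) (μ : Fin (3 + 1)) (z : Site (3 + 1)) (κ : Fin (3 + 1)) (x : Site (3 + 1)),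
      |(((Lc ^ (k + 1 + 1) : ℕ) : ℝ))⁻¹ *
            contourSumAdj (Lc ^ (k + 1 + 1))
              (fun κ' y => (((Lc : ℝ) ^ (k + 1 + 1)) ^ (2 * (3 + 1))) * wΦ (N := Lc ^ (k + 1 + 1)) (d := 3) κ' μ (y - z)) κ x
          - (((Lc ^ (k + 1) : ℕ) : ℝ))⁻¹ *
            contourSumAdj (Lc ^ (k + 1))
              (fun κ' y => (((Lc : ℝ) ^ (k + 1)) ^ (2 * (3 + 1))) * wΦ (N := Lc ^ (k + 1)) (d := 3) κ' μ (y - z)) κ (quo Lc x)|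
        ≤ (A * θt ^ k + B * (((Lc ^ (k + 1) : ℕ) : ℝ))⁻¹) * Real.exp (-(κ₀ * supNorm (quo (Lc ^ (k + 1)) (quo Lc x) - z))))
    (hdl : ∀ (k : ℕ) (μ : Fin (3 + 1)) (z : Site (3 + 1)) (u' : Site (3 + 1)),
      |(Psi (toSite rr) Lc 0 (k + 1) (delta1 μ z) u' - bmGaugeAt (toSite rr) (respStep (d := 3) 1 (Lc ^ (k + 2)) μ z) Lc u')
          - ((Lc : ℝ) ^ (3 + 1))⁻¹ *
            (Psi (toSite rr) Lc 0 k (delta1 μ z) (blk Lc u') - bmGaugeAt (toSite rr) (respStep (d := 3) 1 (Lc ^ (k + 1)) μ z) Lc (blk Lc u'))|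
        ≤ (16 * (Lc : ℝ) * c * θ ^ k * ((Lc : ℝ) ^ (5 * (k + 2)))⁻¹ * (Lc : ℝ) ^ (k + 1) + 8 * (Lc : ℝ) * C * ((Lc : ℝ) ^ (5 * (k + 2)))⁻¹) *
          Real.exp (-(κ₀ * supNorm (quo (Lc ^ (k + 2)) u' - z))))
    (k : ℕ) (κ' : Fin (3 + 1)) (u' : Site (3 + 1)) (α : Fin (3 + 1)) (x' : Site (3 + 1)) (β : Fin (3 + 1)) (z' : Site (3 + 1)) :
    |((Lc : ℝ) ^ (k + 2)) ^ 12 *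
        (∑' x : Site (3 + 1), ∑ κ,
          (Psi (toSite rr) Lc 0 (k + 1) (delta1 α x') - bmGaugeAt (toSite rr) (respStep (d := 3) 1 (Lc ^ (k + 2)) α x') Lc) x
            * respStep (d := 3) 1 (Lc ^ (k + 2)) κ' u' κ x
            * contourSumAdj (Lc ^ (k + 2)) (fun l y => wΦ (N := Lc ^ (k + 2)) (d := 3) l β (y - z')) κ x)
      - ((Lc : ℝ) ^ (k + 1)) ^ 12 *
        (∑' cc : Site (3 + 1), ∑ κ,
          (Psi (toSite rr) Lc 0 k (delta1 α x') - bmGaugeAt (toSite rr) (respStep (d := 3) 1 (Lc ^ (k + 1)) α x') Lc) cc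
            * respStep (d := 3) 1 (Lc ^ (k + 1)) κ' u' κ cc
            * contourSumAdj (Lc ^ (k + 1)) (fun l y => wΦ (N := Lc ^ (k + 1)) (d := 3) l β (y - z')) κ cc)|
      ≤ ((((3 : ℕ) : ℝ)) + 1) *
          ((16 * C) * (c₁ * θ₁ ^ k) * (Φ₀ * Real.exp κ₀) + (16 * C) * C * (A * θt ^ k + B * ((Lc : ℝ) ^ (k + 1))⁻¹)
              + (16 * c * θ ^ k + 8 * C * ((Lc : ℝ) ^ (k + 1))⁻¹) * C * (Φ₀ * Real.exp κ₀)) *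
        (Zl (3 + 1) (κ₀ / (4 * ((((3 : ℕ) : ℝ)) + 1))) * Real.exp (-(κ₀ / 12) * (supNorm (u' - x') + supNorm (z' - x')))) := by
  have hL : 1 ≤ Lc := by omega
  have hL0 : (Lc : ℝ) ≠ 0 := by exact_mod_cast NeZero.ne Lc
  have hLpos : (0 : ℝ) < (Lc : ℝ) := by exact_mod_cast Nat.pos_of_ne_zero (NeZero.ne Lc)
  have hN : 1 ≤ Lc ^ (k + 1) := Nat.one_le_pow _ _ (Nat.pos_of_ne_zero (NeZero.ne Lc))
  have hN' : Lc ^ (k + 2) = Lc * Lc ^ (k + 1) := pow_succ' Lc (k + 1)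
  have hP : ∀ s, s ≤ k → 1 ≤ Lc ^ s := fun s _ => Nat.one_le_pow _ _ (Nat.pos_of_ne_zero (NeZero.ne Lc))
  have hPN : ∀ s, s ≤ k → Lc ^ s ∣ Lc ^ (k + 1) := fun s hs => pow_dvd_pow Lc (by omega)
  have hEψ : (0 : ℝ) ≤ 16 * C := by positivity
  have hE₃ : (0 : ℝ) ≤ Φ₀ * Real.exp κ₀ := by positivity
  have hε₁ : (0 : ℝ) ≤ c₁ * θ₁ ^ k := by positivity
  have hε₃ : (0 : ℝ) ≤ A * θt ^ k + B * ((Lc : ℝ) ^ (k + 1))⁻¹ := by positivity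
  have hεψ : (0 : ℝ) ≤ 16 * c * θ ^ k + 8 * C * ((Lc : ℝ) ^ (k + 1))⁻¹ := by positivity
  have ha : ∀ s : ℕ, (0 : ℝ) ≤ 8 * (Lc : ℝ) * C * ((Lc : ℝ) ^ (k + 1))⁻¹ * (Lc : ℝ) ^ s := fun s => by positivity
  set lam' : Form0 (3 + 1) ℝ := Psi (toSite rr) Lc 0 (k + 1) (delta1 α x') - bmGaugeAt (toSite rr) (respStep (d := 3) 1 (Lc ^ (k + 2)) α x') Lc
    with hlam'
  set lam : Form0 (3 + 1) ℝ := Psi (toSite rr) Lc 0 k (delta1 α x') - bmGaugeAt (toSite rr) (respStep (d := 3) 1 (Lc ^ (k + 1)) α x') Lc with hlam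
  set B' : Form1 (3 + 1) ℝ := respStep (d := 3) 1 (Lc ^ (k + 2)) κ' u' with hB'
  set B₀ : Form1 (3 + 1) ℝ := respStep (d := 3) 1 (Lc ^ (k + 1)) κ' u' with hB₀
  set t' : Form1 (3 + 1) ℝ := contourSumAdj (Lc ^ (k + 2)) (fun l y => wΦ (N := Lc ^ (k + 2)) (d := 3) l β (y - z')) with ht'
  set t₀ : Form1 (3 + 1) ℝ := contourSumAdj (Lc ^ (k + 1)) (fun l y => wΦ (N := Lc ^ (k + 1)) (d := 3) l β (y - z')) with ht₀
  have hψ' : ∀ y : Site (3 + 1), |((Lc : ℝ) ^ (k + 2)) ^ 4 * lam' y| ≤ 16 * C * Real.exp (-(κ₀ * supNorm (quo (Lc ^ (k + 2)) y - x'))) :=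
    fun y => abs_unitGauge_le hLc hC hN1 hrr (k + 1) α x' y
  have hψ : ∀ y : Site (3 + 1), |((Lc : ℝ) ^ (k + 1)) ^ 4 * lam y| ≤ 16 * C * Real.exp (-(κ₀ * supNorm (quo (Lc ^ (k + 1)) y - x'))) :=
    fun y => abs_unitGauge_le hLc hC hN1 hrr k α x' y
  have hG := fun (s : ℕ) (hs : s ≤ k) (y : Site (3 + 1)) => abs_unitGaugePiece_le (κ₀ := κ₀) hN1 hrr k α x' hs y
  have hψG := fun (y : Site (3 + 1)) => unitGauge_eq_staircase (Lc := Lc) (toSite rr) k α x' y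
  have hM' : ∀ κ y, |((Lc : ℝ) ^ (k + 2)) ^ 7 * t' κ y| ≤ Φ₀ * Real.exp κ₀ * Real.exp (-(κ₀ * supNorm (quo (Lc ^ (k + 2)) y - z'))) :=
    fun κ y => abs_unitTent_le ht (k + 1) β z' κ y
  have hT : ∀ κ y, |((Lc : ℝ) ^ (k + 1)) ^ 5 * B₀ κ y| ≤ C * Real.exp (-(κ₀ * supNorm (quo (Lc ^ (k + 1)) y - u'))) :=
    fun κ y => abs_unitLeg_le hN1 k κ' u' κ y
  have hM : ∀ κ y, |((Lc : ℝ) ^ (k + 1)) ^ 7 * t₀ κ y| ≤ Φ₀ * Real.exp κ₀ * Real.exp (-(κ₀ * supNorm (quo (Lc ^ (k + 1)) y - z'))) :=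
    fun κ y => abs_unitTent_le ht k β z' κ y
  have hdT : ∀ κ y, |((Lc : ℝ) ^ (k + 2)) ^ 5 * B' κ y - ((Lc : ℝ) ^ (k + 1)) ^ 5 * B₀ κ (quo Lc y)|
      ≤ c₁ * θ₁ ^ k * Real.exp (-(κ₀ * supNorm (quo (Lc ^ (k + 2)) y - u'))) := fun κ y => abs_unitLeg_refine_le hdB k κ' u' κ y
  have hdM : ∀ κ y, |((Lc : ℝ) ^ (k + 2)) ^ 7 * t' κ y - ((Lc : ℝ) ^ (k + 1)) ^ 7 * t₀ κ (quo Lc y)|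
      ≤ (A * θt ^ k + B * ((Lc : ℝ) ^ (k + 1))⁻¹) * Real.exp (-(κ₀ * supNorm (quo (Lc ^ (k + 2)) y - z'))) :=
    fun κ y => abs_unitTent_refine_le hdt k β z' κ y
  have hdψ : ∀ y : Site (3 + 1), |((Lc : ℝ) ^ (k + 2)) ^ 4 * lam' y - ((Lc : ℝ) ^ (k + 1)) ^ 4 * lam (quo Lc y)|
      ≤ (16 * c * θ ^ k + 8 * C * ((Lc : ℝ) ^ (k + 1))⁻¹) * Real.exp (-(κ₀ * supNorm (quo (Lc ^ (k + 2)) y - x'))) :=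
    fun y => abs_unitGauge_refine_le hdl k α x' y
  have hN'12 : ((((Lc ^ (k + 2) : ℕ) : ℝ)) ^ (3 + 1))⁻¹ * ((Lc : ℝ) ^ (k + 2)) ^ 16 = ((Lc : ℝ) ^ (k + 2)) ^ 12 := by
    rw [Nat.cast_pow]; field_simp
  have hN12 : ((((Lc ^ (k + 1) : ℕ) : ℝ)) ^ (3 + 1))⁻¹ * ((Lc : ℝ) ^ (k + 1)) ^ 16 = ((Lc : ℝ) ^ (k + 1)) ^ 12 := by
    rw [Nat.cast_pow]; field_simp
  obtain ⟨-, -, hEND⟩ := abs_refine3_le (d := 3) (L := Lc) (N := Lc ^ (k + 1)) (N' := Lc ^ (k + 2)) (κ₀ := κ₀)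
    (W' := fun _ y => ((Lc : ℝ) ^ (k + 2)) ^ 4 * lam' y) (W := fun _ y => ((Lc : ℝ) ^ (k + 1)) ^ 4 * lam y)
    (T' := fun κ y => ((Lc : ℝ) ^ (k + 2)) ^ 5 * B' κ y) (M' := fun κ y => ((Lc : ℝ) ^ (k + 2)) ^ 7 * t' κ y)
    (T := fun κ y => ((Lc : ℝ) ^ (k + 1)) ^ 5 * B₀ κ y) (M := fun κ y => ((Lc : ℝ) ^ (k + 1)) ^ 7 * t₀ κ y)
    (z₀ := x') (z₁ := u') (z₃ := z') (Ew := 16 * C) (E₁ := C) (E₃ := Φ₀ * Real.exp κ₀)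
    (εw := 16 * c * θ ^ k + 8 * C * ((Lc : ℝ) ^ (k + 1))⁻¹) (ε₁ := c₁ * θ₁ ^ k) (ε₃ := A * θt ^ k + B * ((Lc : ℝ) ^ (k + 1))⁻¹)
    hL hN hN' hκ hEψ hC hE₃ hεψ hε₁ hε₃ (fun _ y => hψ' y) hM' (fun _ y => hψ y) hT hM hdT hdM (fun _ y => hdψ y)
  have hpt' : ∀ y : Site (3 + 1), (∑ κ, ((Lc : ℝ) ^ (k + 2)) ^ 4 * lam' y * (((Lc : ℝ) ^ (k + 2)) ^ 5 * B' κ y) *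
      (((Lc : ℝ) ^ (k + 2)) ^ 7 * t' κ y)) = ((Lc : ℝ) ^ (k + 2)) ^ 16 * ∑ κ, lam' y * B' κ y * t' κ y := by
    intro y; rw [Finset.mul_sum]; exact Finset.sum_congr rfl fun κ _ => by ring
  have hpt : ∀ y : Site (3 + 1), (∑ κ, ((Lc : ℝ) ^ (k + 1)) ^ 4 * lam y * (((Lc : ℝ) ^ (k + 1)) ^ 5 * B₀ κ y) *
      (((Lc : ℝ) ^ (k + 1)) ^ 7 * t₀ κ y)) = ((Lc : ℝ) ^ (k + 1)) ^ 16 * ∑ κ, lam y * B₀ κ y * t₀ κ y := by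
    intro y; rw [Finset.mul_sum]; exact Finset.sum_congr rfl fun κ _ => by ring
  rw [tsum_congr hpt', tsum_congr hpt, tsum_mul_left, tsum_mul_left, ← mul_assoc, ← mul_assoc, hN'12, hN12] at hEND
  exact hEND

end Atoms

end Summit.QuantumFields.BalabanUV.Beta.GAN24.ContactRefineBThree

end
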